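import Summits.ValiantsHypothesis.ValiantsHypothesis.Theorems.GrenetZeonDualUnipotentThreeHalvesHeavyTopCompositionBound

/-!
# `GrenetZeon.DualUnipotentThreeHalves` (stmt-ValiantsHypothesis-24318), LINE α `krylov_seed`, stub S1a `stub_coarseFlag`:
# THE COARSE FLAG LEMMA — a small-block structure coarsens into a cheap block flag (the census τ-law in kernel currency)

Lead prover val-port-2 g2 (director R283 / R285 (2); skeleton `Cruxes/DualUnipotentThreeHalves/Lines/krylov_seed.lean` @0e5677d8beda,
registered stub `stub_coarseFlag : CoarseFlagLaw`).  Statement = the line's `CoarseFlagLaw` with its two line-file definitions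
`SmallBlockStructure` / `HasCheapBlockFlag` UNFOLDED verbatim (a Theorems file cannot import the Cruxes workfile); the line wires
`stub_coarseFlag := KrylovSeed.coarseFlagLaw_unfolded` by `δ`.

MATHEMATICS (pure bookkeeping of a level function; the pencil only rides along).  Let `lvl : Fin m → ℕ` have every level of size `≤ s`
(`s ≥ 1`).  Put `key i := #{j : lvl j < lvl i}` and COARSEN to `lvl' i := key i / s`.  Then: `lvl'` is monotone in `lvl`, so a pencil
that is block-upper for `lvl` is block-upper for `lvl'` (`coarse_blockUpper`); `lvl' < m/s + 1` (`coarse_lt`); every coarse block has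
`≤ 2s − 1` elements (`card_coarse_le`: its levels form an interval of the cut profile inside one residue window of length `s`, plus one
top level of size `≤ s` — ✓ port-4 g2's `cut_succ`); hence `Σ_u C(#{lvl' = u}, 2) ≤ (s − 1)·m ≤ s·m` (`sum_choose_coarse_le`), and the
Theorem-G budget of the coarse flag is `≤ (m/s + 1)·n + s·m`.  ★ `coarseFlagLaw_unfolded`: S1a.

Honest framing.  A combinatorial helper (`--supports stmt-ValiantsHypothesis-24318`); it proves the registered stub S1a of line α and
NOTHING about C⁺ `UniformWeightLaw`, R2 `HeavyTopLaw`, the crux, rung 8062 or `VP ≠ VNP` — all OPEN / NOT proved.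
[line α skeleton; val-htc-lead g0's LEMMA T 17:38:37Z; ✓ p649082 `cut_succ`]
-/

-- `Summit.ValiantsHypothesis.ValiantsHypothesis.…` repeats a component (D-0017 layout); `dupNamespace` would flag the mandated name.
set_option linter.dupNamespace false
set_option autoImplicit false

noncomputable section

namespace Summit.ValiantsHypothesis.ValiantsHypothesis.Theorems.GrenetZeon.KrylovSeed

open MvPolynomial Matrix
open scoped BigOperators
open Summit.ValiantsHypothesis.ValiantsHypothesis.Cruxes.TwoDimCoefficients.DimTwoCases (AffMat IsAffine)
open Summit.ValiantsHypothesis.ValiantsHypothesis.Theorems.GrenetZeon.HeavyTopCompositionBound (cut_succ)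

variable {m : ℕ}

/-! ## §1 The coarsening of a level function -/

/-- The key of an index: the number of indices at strictly lower levels. -/
theorem key_le_of_le (lvl : Fin m → ℕ) {i j : Fin m} (h : lvl i ≤ lvl j) :
    (Finset.univ.filter fun k => lvl k < lvl i).card ≤ (Finset.univ.filter fun k => lvl k < lvl j).card := by
  classical
  exact Finset.card_le_card (fun k hk => by
    simp only [Finset.mem_filter, Finset.mem_univ, true_and] at hk ⊢; omega)

/-- Keys are `≤ m − 1` (the index itself is not below its own level). -/
theorem key_le_pred (lvl : Fin m → ℕ) (i : Fin m) :
    (Finset.univ.filter fun k => lvl k < lvl i).card ≤ m - 1 := by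
  classical
  have h : (Finset.univ.filter fun k => lvl k < lvl i) ⊆ Finset.univ.erase i := fun k hk => by
    simp only [Finset.mem_filter, Finset.mem_univ, true_and] at hk
    simp only [Finset.mem_erase, Finset.mem_univ, and_true]
    intro hki; subst hki; omega
  have := Finset.card_le_card h
  rwa [Finset.card_erase_of_mem (Finset.mem_univ i), Finset.card_univ, Fintype.card_fin] at this

/-- **Monotonicity**: the coarse level `key / s` is monotone in the level, so `lvl' i < lvl' j ⇒ lvl i < lvl j`. -/
theorem coarse_lt_imp (lvl : Fin m → ℕ) (s : ℕ) {i j : Fin m}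
    (h : (Finset.univ.filter fun k => lvl k < lvl i).card / s < (Finset.univ.filter fun k => lvl k < lvl j).card / s) :
    lvl i < lvl j := by
  by_contra hle
  have := Nat.div_le_div_right (c := s) (key_le_of_le lvl (le_of_not_gt hle : lvl j ≤ lvl i))
  omega

/-- The coarse levels are `< m / s + 1`. -/
theorem coarse_lt (lvl : Fin m → ℕ) (s : ℕ) (i : Fin m) :
    (Finset.univ.filter fun k => lvl k < lvl i).card / s < m / s + 1 := by
  have h1 := Nat.div_le_div_right (c := s) (key_le_pred lvl i)
  have h2 : (m - 1) / s ≤ m / s := Nat.div_le_div_right (Nat.sub_le m 1)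
  omega

/-- Indices with level in an interval `[a, b]` number `cut(b+1) − cut(a)`. -/
theorem card_level_Icc (lvl : Fin m → ℕ) (a b : ℕ) (hab : a ≤ b) :
    (Finset.univ.filter fun k => a ≤ lvl k ∧ lvl k ≤ b).card =
      (Finset.univ.filter fun k => lvl k < b + 1).card - (Finset.univ.filter fun k => lvl k < a).card := by
  classical
  have hsub : (Finset.univ.filter fun k => lvl k < a) ⊆ (Finset.univ.filter fun k => lvl k < b + 1) := fun k hk => by
    simp only [Finset.mem_filter, Finset.mem_univ, true_and] at hk ⊢; omega
  have heq : (Finset.univ.filter fun k => a ≤ lvl k ∧ lvl k ≤ b) =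
      (Finset.univ.filter fun k => lvl k < b + 1) \ (Finset.univ.filter fun k => lvl k < a) := by
    ext k; simp only [Finset.mem_filter, Finset.mem_univ, true_and, Finset.mem_sdiff]; omega
  rw [heq, Finset.card_sdiff_of_subset hsub]

/-- **Coarse blocks are short**: if every level has `≤ s` elements (`s ≥ 1`), every coarse block `{i : key i / s = u}` has
`≤ 2s − 1` elements. -/
theorem card_coarse_le (lvl : Fin m → ℕ) (s : ℕ) (hs : 1 ≤ s) {L : ℕ} (hlvl : ∀ i, lvl i < L)
    (hsmall : ∀ t, t < L → (Finset.univ.filter fun i => lvl i = t).card ≤ s) (u : ℕ) :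
    (Finset.univ.filter fun i => (Finset.univ.filter fun k => lvl k < lvl i).card / s = u).card ≤ 2 * s - 1 := by
  classical
  set G := Finset.univ.filter fun i => (Finset.univ.filter fun k => lvl k < lvl i).card / s = u with hG
  rcases G.eq_empty_or_nonempty with hempty | hne
  · rw [hempty, Finset.card_empty]; omega
  obtain ⟨i₁, hi₁, hmin⟩ := G.exists_min_image lvl hne
  obtain ⟨i₂, hi₂, hmax⟩ := G.exists_max_image lvl hne
  have hk₁ : (Finset.univ.filter fun k => lvl k < lvl i₁).card / s = u := by
    have := hi₁; rw [hG, Finset.mem_filter] at this; exact this.2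
  have hk₂ : (Finset.univ.filter fun k => lvl k < lvl i₂).card / s = u := by
    have := hi₂; rw [hG, Finset.mem_filter] at this; exact this.2
  -- G sits inside the level interval [lvl i₁, lvl i₂]
  have hGsub : G ⊆ Finset.univ.filter fun k => lvl i₁ ≤ lvl k ∧ lvl k ≤ lvl i₂ := fun k hk => by
    simp only [Finset.mem_filter, Finset.mem_univ, true_and]
    exact ⟨hmin k hk, hmax k hk⟩
  have h12 : lvl i₁ ≤ lvl i₂ := hmin i₂ hi₂
  have hcard := Finset.card_le_card hGsub
  rw [card_level_Icc lvl _ _ h12, cut_succ lvl (lvl i₂)] at hcard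
  -- the two keys lie in the same residue window of length s
  have hwin : (Finset.univ.filter fun k => lvl k < lvl i₂).card <
      (Finset.univ.filter fun k => lvl k < lvl i₁).card + s := by
    have h1 := Nat.div_add_mod ((Finset.univ.filter fun k => lvl k < lvl i₁).card) s
    have h2 := Nat.div_add_mod ((Finset.univ.filter fun k => lvl k < lvl i₂).card) s
    have h3 := Nat.mod_lt ((Finset.univ.filter fun k => lvl k < lvl i₂).card) (by omega : 0 < s)
    rw [hk₁] at h1; rw [hk₂] at h2
    omega
  have htop := hsmall (lvl i₂) (hlvl i₂)
  have hmono := key_le_of_le lvl h12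
  omega

/-- `C(g, 2) ≤ g·(s − 1)` for `g ≤ 2s − 1`. -/
theorem choose_two_le_of_le {g s : ℕ} (hg : g ≤ 2 * s - 1) : g.choose 2 ≤ g * (s - 1) := by
  rw [Nat.choose_two_right]
  have h1 : g * (g - 1) ≤ g * (2 * (s - 1)) := Nat.mul_le_mul_left g (by omega)
  calc g * (g - 1) / 2 ≤ g * (2 * (s - 1)) / 2 := Nat.div_le_div_right h1
    _ = g * (s - 1) := by rw [mul_left_comm, Nat.mul_div_cancel_left _ (by norm_num)]

/-- **The Gerstenhaber sum of the coarse flag** is `≤ s·m`. -/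
theorem sum_choose_coarse_le (lvl : Fin m → ℕ) (s : ℕ) (hs : 1 ≤ s) {L : ℕ} (hlvl : ∀ i, lvl i < L)
    (hsmall : ∀ t, t < L → (Finset.univ.filter fun i => lvl i = t).card ≤ s) :
    ∑ u ∈ Finset.range (m / s + 1),
        ((Finset.univ.filter fun i => (Finset.univ.filter fun k => lvl k < lvl i).card / s = u).card).choose 2 ≤ s * m := by
  classical
  have hfib : ∑ u ∈ Finset.range (m / s + 1),
      (Finset.univ.filter fun i => (Finset.univ.filter fun k => lvl k < lvl i).card / s = u).card = m := by
    have h := Finset.card_eq_sum_card_fiberwise (s := (Finset.univ : Finset (Fin m))) (t := Finset.range (m / s + 1))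
      (f := fun i => (Finset.univ.filter fun k => lvl k < lvl i).card / s)
      (fun i _ => Finset.mem_range.2 (coarse_lt lvl s i))
    rw [Finset.card_univ, Fintype.card_fin] at h
    exact h.symm
  calc ∑ u ∈ Finset.range (m / s + 1),
        ((Finset.univ.filter fun i => (Finset.univ.filter fun k => lvl k < lvl i).card / s = u).card).choose 2
      ≤ ∑ u ∈ Finset.range (m / s + 1),
        (Finset.univ.filter fun i => (Finset.univ.filter fun k => lvl k < lvl i).card / s = u).card * (s - 1) :=
          Finset.sum_le_sum fun u _ => choose_two_le_of_le (card_coarse_le lvl s hs hlvl hsmall u)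
    _ = m * (s - 1) := by rw [← Finset.sum_mul, hfib]
    _ ≤ s * m := by
          rw [mul_comm]; exact Nat.mul_le_mul_right m (Nat.sub_le s 1)

/-! ## §2 S1a: the coarse flag lemma for pencils -/

/-- ★ **S1a `CoarseFlagLaw`, UNFOLDED** (the line's `SmallBlockStructure` ⇒ `HasCheapBlockFlag`, both δ-unfolded): a pencil that is
block-upper after a constant change of basis for a level function all of whose levels have `≤ s` elements (`s ≥ 1`) has a CHEAP block
flag as soon as `(m/s + 1)·n + s·m < n²` — the coarse flag `lvl' i = #{lvl < lvl i} / s` with `p = m/s + 1` levels.  (`IsAffine` is part of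
the registered signature and unused.) [this file] -/
theorem coarseFlagLaw_unfolded :
    ∀ (n m : ℕ) (N : AffMat n m) (s : ℕ), 1 ≤ s → IsAffine N →
      (∃ (P : (Matrix (Fin m) (Fin m) ℂ)ˣ) (L : ℕ) (lvl : Fin m → ℕ), (∀ i, lvl i < L) ∧
        (∀ i j : Fin m, lvl i < lvl j →
          ((P : Matrix (Fin m) (Fin m) ℂ).map C * N * (↑P⁻¹ : Matrix (Fin m) (Fin m) ℂ).map C :
            Matrix (Fin m) (Fin m) (MvPolynomial (Fin n × Fin n) ℂ)) i j = 0) ∧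
        (∀ t, t < L → (Finset.univ.filter fun i => lvl i = t).card ≤ s)) →
      (m / s + 1) * n + s * m < n ^ 2 →
      ∃ (P : (Matrix (Fin m) (Fin m) ℂ)ˣ) (lvl : Fin m → ℕ) (p : ℕ), 1 ≤ p ∧ (∀ i, lvl i < p) ∧
        (∀ i j : Fin m, lvl i < lvl j →
          ((P : Matrix (Fin m) (Fin m) ℂ).map C * N * (↑P⁻¹ : Matrix (Fin m) (Fin m) ℂ).map C :
            Matrix (Fin m) (Fin m) (MvPolynomial (Fin n × Fin n) ℂ)) i j = 0) ∧
        p * n + ∑ t ∈ Finset.range p, ((Finset.univ.filter fun i => lvl i = t).card).choose 2 < n ^ 2 := by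
  classical
  intro n m N s hs _hN ⟨P, L, lvl, hlvl, hblock, hsmall⟩ hbudget
  refine ⟨P, fun i => (Finset.univ.filter fun k => lvl k < lvl i).card / s, m / s + 1, Nat.succ_pos _,
    fun i => coarse_lt lvl s i, fun i j hij => hblock i j (coarse_lt_imp lvl s hij), ?_⟩
  have hsum : (∑ t ∈ Finset.range (m / s + 1),
      ((Finset.univ.filter fun i => (fun i => (Finset.univ.filter fun k => lvl k < lvl i).card / s) i = t).card).choose 2)
        ≤ s * m := sum_choose_coarse_le lvl s hs hlvl hsmall
  omega

end Summit.ValiantsHypothesis.ValiantsHypothesis.Theorems.GrenetZeon.KrylovSeed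

end
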